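import Summits.Ventures.PercRepro2.CaseOneCoreTF

/-!
# The two faces of the uwob gadget: `u ~ {w, o}` and `u ~ {w, b}` with `w ~ {u, a₁, a₂}` are six-form closed
(blind cell PercRepro2, p1 g32)

The uwob gadget with its `b`-edge absent (`IsGadgetUWOFace`: `u` adjacent exactly to an unmarked `w`
and to `o`, `w` adjacent exactly to `u, a₁, a₂`) is the face of the gadget instance on `Option E` in
which the new edge `none` is `{b, u}` (**`IsGadgetUWOFace.ext`**); likewise with the `o`-edge absent
(`IsGadgetUWBFace`, **`IsGadgetUWBFace.ext`**). Hence both are `FaceAnchor`s of `GadgetUWOBAnchor`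
(`faceAnchor_of_gadgetUWOFace` / `…UWBFace`), `ClosedAnchorTF` anchors, and six-form closed for every
weight vector (**`closedAtT_of_gadgetUWOFace`**, **`closedAtT_of_gadgetUWBFace`**, by `closedAtT_of_ext`
and `closedAtT_of_gadgetUWOB`) — two classes the four-form anchors do not name. Own code; standard
axioms. -/

namespace Summit.Ventures.PercRepro2

namespace CaseOne

universe u

section FaceDef
variable {V : Type*} {E : Type*}

/-- **The uwob gadget with its `b`-edge absent**: `u ~ {w, o}` (edges `euw`, `euo`), `w ~ {u, a₁, a₂}`
(edges `euw`, `ewa1`, `ewa2`), no other edge at `u` or `w`, all the distinctness of `IsGadgetUWOB`. -/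
structure IsGadgetUWOFace (ends : E → Sym2 V) (o a₁ a₂ b u w : V) (euw euo ewa1 ewa2 : E) : Prop where
  /-- the edge `{w, u}` -/
  ends_uw : ends euw = s(w, u)
  /-- the edge `{o, u}` -/
  ends_uo : ends euo = s(o, u)
  /-- the edge `{a₁, w}` -/
  ends_wa1 : ends ewa1 = s(a₁, w)
  /-- the edge `{a₂, w}` -/
  ends_wa2 : ends ewa2 = s(a₂, w)
  /-- distinct edges -/
  ne_uw_uo : euw ≠ euo
  /-- distinct edges -/
  ne_uw_wa1 : euw ≠ ewa1
  /-- distinct edges -/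
  ne_uw_wa2 : euw ≠ ewa2
  /-- distinct edges -/
  ne_uo_wa1 : euo ≠ ewa1
  /-- distinct edges -/
  ne_uo_wa2 : euo ≠ ewa2
  /-- distinct edges -/
  ne_wa1_wa2 : ewa1 ≠ ewa2
  /-- no other edge at `u` -/
  unique_u : ∀ e, u ∈ ends e → e = euw ∨ e = euo
  /-- no other edge at `w` -/
  unique_w : ∀ e, w ∈ ends e → e = euw ∨ e = ewa1 ∨ e = ewa2
  /-- `w ≠ u` -/
  ne_wu : w ≠ u
  /-- `o ≠ u` -/
  ne_ou : o ≠ u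
  /-- `b ≠ u` -/
  ne_bu : b ≠ u
  /-- `a₁ ≠ u` -/
  ne_a1u : a₁ ≠ u
  /-- `a₂ ≠ u` -/
  ne_a2u : a₂ ≠ u
  /-- `a₁ ≠ w` -/
  ne_a1w : a₁ ≠ w
  /-- `a₂ ≠ w` -/
  ne_a2w : a₂ ≠ w
  /-- `o ≠ w` -/
  ne_ow : o ≠ w
  /-- `b ≠ w` -/
  ne_bw : b ≠ w

variable {ends : E → Sym2 V} {o a₁ a₂ b u w : V} {euw euo ewa1 ewa2 : E}

/-- **The face is the gadget with the absent `b`-edge added**: on `Option E` with the new edge `none`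
as `{b, u}`, the extension is an `IsGadgetUWOB` instance. -/
theorem IsGadgetUWOFace.ext (h : IsGadgetUWOFace ends o a₁ a₂ b u w euw euo ewa1 ewa2) :
    IsGadgetUWOB (extEnds ends s(b, u)) o a₁ a₂ b u w (some euw) (some euo) none (some ewa1)
      (some ewa2) where
  ends_uw := h.ends_uw
  ends_uo := h.ends_uo
  ends_ub := rfl
  ends_wa1 := h.ends_wa1
  ends_wa2 := h.ends_wa2
  ne_uw_uo := by simpa using h.ne_uw_uo
  ne_uw_ub := by simp
  ne_uw_wa1 := by simpa using h.ne_uw_wa1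
  ne_uw_wa2 := by simpa using h.ne_uw_wa2
  ne_uo_ub := by simp
  ne_uo_wa1 := by simpa using h.ne_uo_wa1
  ne_uo_wa2 := by simpa using h.ne_uo_wa2
  ne_ub_wa1 := by simp
  ne_ub_wa2 := by simp
  ne_wa1_wa2 := by simpa using h.ne_wa1_wa2
  unique_u := fun e he => by
    cases e with
    | none => exact Or.inr (Or.inr rfl)
    | some e =>
      rcases h.unique_u e he with rfl | rfl
      · exact Or.inl rfl
      · exact Or.inr (Or.inl rfl)
  unique_w := fun e he => by
    cases e with
    | none =>
      rcases Sym2.mem_iff.1 he with hw | hw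
      · exact absurd hw.symm h.ne_bw
      · exact absurd hw h.ne_wu
    | some e =>
      rcases h.unique_w e he with rfl | rfl | rfl
      · exact Or.inl rfl
      · exact Or.inr (Or.inl rfl)
      · exact Or.inr (Or.inr rfl)
  ne_wu := h.ne_wu
  ne_ou := h.ne_ou
  ne_bu := h.ne_bu
  ne_a1u := h.ne_a1u
  ne_a2u := h.ne_a2u
  ne_a1w := h.ne_a1w
  ne_a2w := h.ne_a2w
  ne_ow := h.ne_ow
  ne_bw := h.ne_bw

/-- **The uwob gadget with its `o`-edge absent**: `u ~ {w, b}` (edges `euw`, `eub`), `w ~ {u, a₁, a₂}`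
(edges `euw`, `ewa1`, `ewa2`), no other edge at `u` or `w`, all the distinctness of `IsGadgetUWOB`. -/
structure IsGadgetUWBFace (ends : E → Sym2 V) (o a₁ a₂ b u w : V) (euw eub ewa1 ewa2 : E) : Prop where
  /-- the edge `{w, u}` -/
  ends_uw : ends euw = s(w, u)
  /-- the edge `{b, u}` -/
  ends_ub : ends eub = s(b, u)
  /-- the edge `{a₁, w}` -/
  ends_wa1 : ends ewa1 = s(a₁, w)
  /-- the edge `{a₂, w}` -/
  ends_wa2 : ends ewa2 = s(a₂, w)
  /-- distinct edges -/
  ne_uw_ub : euw ≠ eub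
  /-- distinct edges -/
  ne_uw_wa1 : euw ≠ ewa1
  /-- distinct edges -/
  ne_uw_wa2 : euw ≠ ewa2
  /-- distinct edges -/
  ne_ub_wa1 : eub ≠ ewa1
  /-- distinct edges -/
  ne_ub_wa2 : eub ≠ ewa2
  /-- distinct edges -/
  ne_wa1_wa2 : ewa1 ≠ ewa2
  /-- no other edge at `u` -/
  unique_u : ∀ e, u ∈ ends e → e = euw ∨ e = eub
  /-- no other edge at `w` -/
  unique_w : ∀ e, w ∈ ends e → e = euw ∨ e = ewa1 ∨ e = ewa2
  /-- `w ≠ u` -/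
  ne_wu : w ≠ u
  /-- `o ≠ u` -/
  ne_ou : o ≠ u
  /-- `b ≠ u` -/
  ne_bu : b ≠ u
  /-- `a₁ ≠ u` -/
  ne_a1u : a₁ ≠ u
  /-- `a₂ ≠ u` -/
  ne_a2u : a₂ ≠ u
  /-- `a₁ ≠ w` -/
  ne_a1w : a₁ ≠ w
  /-- `a₂ ≠ w` -/
  ne_a2w : a₂ ≠ w
  /-- `o ≠ w` -/
  ne_ow : o ≠ w
  /-- `b ≠ w` -/
  ne_bw : b ≠ w

/-- **The `o`-free face is the gadget with the absent `o`-edge added**: on `Option E` with the new edge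
`none` as `{o, u}`, the extension is an `IsGadgetUWOB` instance. -/
theorem IsGadgetUWBFace.ext {eub : E} (h : IsGadgetUWBFace ends o a₁ a₂ b u w euw eub ewa1 ewa2) :
    IsGadgetUWOB (extEnds ends s(o, u)) o a₁ a₂ b u w (some euw) none (some eub) (some ewa1)
      (some ewa2) where
  ends_uw := h.ends_uw
  ends_uo := rfl
  ends_ub := h.ends_ub
  ends_wa1 := h.ends_wa1
  ends_wa2 := h.ends_wa2
  ne_uw_uo := by simp
  ne_uw_ub := by simpa using h.ne_uw_ub
  ne_uw_wa1 := by simpa using h.ne_uw_wa1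
  ne_uw_wa2 := by simpa using h.ne_uw_wa2
  ne_uo_ub := by simp
  ne_uo_wa1 := by simp
  ne_uo_wa2 := by simp
  ne_ub_wa1 := by simpa using h.ne_ub_wa1
  ne_ub_wa2 := by simpa using h.ne_ub_wa2
  ne_wa1_wa2 := by simpa using h.ne_wa1_wa2
  unique_u := fun e he => by
    cases e with
    | none => exact Or.inr (Or.inl rfl)
    | some e =>
      rcases h.unique_u e he with rfl | rfl
      · exact Or.inl rfl
      · exact Or.inr (Or.inr rfl)
  unique_w := fun e he => by
    cases e with
    | none =>
      rcases Sym2.mem_iff.1 he with hw | hw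
      · exact absurd hw.symm h.ne_ow
      · exact absurd hw h.ne_wu
    | some e =>
      rcases h.unique_w e he with rfl | rfl | rfl
      · exact Or.inl rfl
      · exact Or.inr (Or.inl rfl)
      · exact Or.inr (Or.inr rfl)
  ne_wu := h.ne_wu
  ne_ou := h.ne_ou
  ne_bu := h.ne_bu
  ne_a1u := h.ne_a1u
  ne_a2u := h.ne_a2u
  ne_a1w := h.ne_a1w
  ne_a2w := h.ne_a2w
  ne_ow := h.ne_ow
  ne_bw := h.ne_bw

end FaceDef

section FaceAnchors
variable {V : Type*} {E : Type u} [Fintype E] [DecidableEq E]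
variable {ends : E → Sym2 V} {o a₁ a₂ b u w : V} {euw euo ewa1 ewa2 : E}

/-- The `b`-free face of the uwob gadget is a face of a uwob-gadget anchor. -/
theorem faceAnchor_of_gadgetUWOFace (h : IsGadgetUWOFace ends o a₁ a₂ b u w euw euo ewa1 ewa2) :
    FaceAnchor (fun E₀ _ _ ends₀ v₀ => GadgetUWOBAnchor o a₁ a₂ b E₀ ends₀ v₀) E ends u :=
  ⟨s(b, u), w, some euw, some euo, none, some ewa1, some ewa2, h.ext⟩

/-- The `b`-free face of the uwob gadget is a `ClosedAnchorTF` anchor (one face of a closed anchor). -/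
theorem closedAnchorTF_of_gadgetUWOFace (h : IsGadgetUWOFace ends o a₁ a₂ b u w euw euo ewa1 ewa2) :
    ClosedAnchorTF o a₁ a₂ b E ends u :=
  ⟨1, s(b, u), Or.inl (Or.inr (Or.inr (Or.inl ⟨w, some euw, some euo, none, some ewa1, some ewa2,
    h.ext⟩)))⟩

/-- The `o`-free face of the uwob gadget is a face of a uwob-gadget anchor. -/
theorem faceAnchor_of_gadgetUWBFace {eub : E} (h : IsGadgetUWBFace ends o a₁ a₂ b u w euw eub ewa1 ewa2) :
    FaceAnchor (fun E₀ _ _ ends₀ v₀ => GadgetUWOBAnchor o a₁ a₂ b E₀ ends₀ v₀) E ends u :=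
  ⟨s(o, u), w, some euw, none, some eub, some ewa1, some ewa2, h.ext⟩

/-- The `o`-free face of the uwob gadget is a `ClosedAnchorTF` anchor. -/
theorem closedAnchorTF_of_gadgetUWBFace {eub : E} (h : IsGadgetUWBFace ends o a₁ a₂ b u w euw eub ewa1 ewa2) :
    ClosedAnchorTF o a₁ a₂ b E ends u :=
  ⟨1, s(o, u), Or.inl (Or.inr (Or.inr (Or.inl ⟨w, some euw, none, some eub, some ewa1, some ewa2,
    h.ext⟩)))⟩

end FaceAnchors

section FaceClosed
variable {V : Type*} {E : Type u} [Fintype E] [DecidableEq E] [Fintype V] [DecidableEq V]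
  {R : Type*} [Field R] [LinearOrder R] [IsStrictOrderedRing R]
variable {ends : E → Sym2 V} {o a₁ a₂ b u w : V} {euw euo ewa1 ewa2 : E}

/-- **The uwob gadget with its `b`-edge absent is six-form closed**: `u ~ {w, o}`, `w ~ {u, a₁, a₂}`,
every finite graph, every weight vector. -/
theorem closedAtT_of_gadgetUWOFace (h : IsGadgetUWOFace ends o a₁ a₂ b u w euw euo ewa1 ewa2) :
    ClosedAtT (R := R) o a₁ a₂ b E ends u :=
  closedAtT_of_ext (closedAtT_of_gadgetUWOB h.ext)

/-- **The uwob gadget with its `o`-edge absent is six-form closed**: `u ~ {w, b}`, `w ~ {u, a₁, a₂}`,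
every finite graph, every weight vector. -/
theorem closedAtT_of_gadgetUWBFace {eub : E} (h : IsGadgetUWBFace ends o a₁ a₂ b u w euw eub ewa1 ewa2) :
    ClosedAtT (R := R) o a₁ a₂ b E ends u :=
  closedAtT_of_ext (closedAtT_of_gadgetUWOB h.ext)

end FaceClosed

end CaseOne

end Summit.Ventures.PercRepro2
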